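import Literature.Barriers.HodgeConjecture.ConjugateVarietiesSerreTopologyProofs
import Literature.Barriers.HodgeConjecture.ConjugateVarietiesSerreArithmeticProofs
import Literature.Barriers.HodgeConjecture.ConjugateVarietiesProofs
import HarnessLib

/-!
# Serre 1964 for `p = 23`: the topological half without class numbers (proved)

Companion to `ConjugateVarietiesSerreTopologyProofs.lean` (the TOPOLOGICAL half of Serre's note —
orbit spaces `(Y × V/Λ)/G` of Serre's shape are not homeomorphic — proved there for a subfield
`k ⊆ ℚ(ζ_p)`, a non-principal `𝔟 ⊂ 𝓞 k` and the CLASS-NUMBER hypothesis `([ℚ(ζ_p) : k], h_k) = 1`)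
and to `ConjugateVarietiesSerreArithmeticProofs.lean` (Serre's no. 1 for `p = 23` with that
hypothesis discharged: `D = 𝓞 ℚ(ω)`, `ω² = ω - 6`, `𝔭 = (2, ω)`, `𝔭¹¹` not principal, and the
algebraic Théorème `isEmpty_mulEquiv_twentyThree`).  This file joins the two: the whole chain of
`ConjugateVarietiesSerreTopologyProofs.lean`, for `p = 23`, with NO class-number hypothesis and all
ring data explicit.  Proofs only; no definitions, no named facts.

J.-P. Serre, C. R. Acad. Sci. Paris 258 (1964) 4194–4196 (= *Œuvres* II no. 63): no. 1 ("prenons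
par exemple `p = 23`, auquel cas `h = 3`"), no. 2 ("`V` le quotient de `Y × A` par `G` …
`π₁(V_φ)` s'identifie au produit semi-direct de `G` par `π₁(A_φ)`"), Théorème p. 4196.

* `exists_model_of_quotientCovering`, `exists_prodModel_of_fixedPoint` — the one-sided content of
  the topological half (factored out of the two-sided proofs of the sibling file): a quotient
  covering `q : E → E/G` by a group of order `p` with `π₁(E, e) ≅ L` on which the deck
  transformation `g⁻¹`, transported back along `δ : e ⟶ g•e`, acts as `T`, yields in
  `π₁(E/G, q e)` an injective normal index-`p` copy of `L` normalised by `[q ∘ δ]` acting as `T`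
  (Hatcher 1.39–1.40); and for `E = Y × A`, `Y` simply connected, the datum descends from `A`.
* `isEmpty_mulEquiv_fundamentalGroup_of_quotientCovering_twentyThree`,
  `isEmpty_homeomorph_of_torusModels_twentyThree`,
  `isEmpty_homeomorph_orbitSpace_of_latticeModels_twentyThree` — the sibling file's theorems for
  `p = 23`, lattices `Λ₁ ≅ 𝓞 ℚ(ζ₂₃)` and `Λ₂ ≅ 𝔭·𝓞 ℚ(ζ₂₃)`, a generator acting as `ζ₂₃`: the orbit
  spaces are not homeomorphic, unconditionally.
* `serre1964_twentyThree_of_latticeModels` — hence `Serre1964_conjugateVarieties_notHomeomorphic`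
  as soon as, for some smooth projective `V` over a number field and embeddings `φ, ψ`,
  `V_φ(ℂ)` and `V_ψ(ℂ)` are homeomorphic to two such lattice models (`serre1964_of_numberField_form`):
  what is left is Serre's `V = (Y × E¹¹)/(ℤ/23)` over the Hilbert class field of `ℚ(√-23)` with
  `V_φ(ℂ) ≃ₜ (Y(ℂ) × ℂ¹¹/Λ_φ)/G`, `Y(ℂ)` simply connected (Lefschetz) and `Λ_φ ≅ 𝓞 ℚ(ζ₂₃)`,
  `Λ_ψ ≅ 𝔭·𝓞 ℚ(ζ₂₃)` `ζ₂₃`-equivariantly (uniformisation of the CM abelian varieties `A_φ = E_φ¹¹`,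
  `π₁(E_φ) ≅ D`, `π₁(E_ψ) ≅ 𝔭`) — algebraic geometry and CM theory only.

## References

* [Serre1964Conjugate] J.-P. Serre, C. R. Acad. Sci. Paris 258 (1964) 4194–4196, nos. 1–2,
  Lemme 2, Théorème p. 4196.
* [HatcherAT2002] A. Hatcher, *Algebraic Topology*, Props. 1.12, 1.39, 1.40.
-/

noncomputable section

namespace Literature.Barriers.HodgeConjecture.Serre1964

open NumberField Multiplicative IntermediateField Literature.AlgebraicTopology.FundamentalGroup

/-! ### The one-sided content of the topological half -/

section OneSided

/-- **`π₁` of a quotient covering, one side** (Hatcher 1.39–1.40; the common content of the two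
"sides" of `isEmpty_mulEquiv_fundamentalGroup_of_quotientCovering`): for a quotient covering map
`q : E → X` by a group `G` of order `p` of a path-connected space, a base point `e`, `g ∈ G`, a
path `δ : e ⟶ g • e` and an isomorphism `j : L ≅ π₁(E, e)` carrying `T : L → L` to the twisted
transport `β ↦ g⁻¹ ∘ (δ⁻¹ β δ)`, the subgroup `q_* π₁(E, e) ≅ L` of `π₁(X, q e)` is injective,
normal, of index `p`, and `[q ∘ δ]` acts on it as `T`. [cite: HatcherAT2002, Props. 1.39, 1.40] -/
theorem exists_model_of_quotientCovering {L : Type*} [AddGroup L] (T : L → L)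
    {E X G : Type*} [TopologicalSpace E] [TopologicalSpace X] [Group G] [MulAction G E]
    [ContinuousConstSMul G E] [PathConnectedSpace E] {q : E → X} (hq : IsQuotientCoveringMap q G)
    {p : ℕ} (hG : Nat.card G = p) (e : E) (g : G) (δ : Path e (g • e))
    (j : Multiplicative L ≃* FundamentalGroup E e)
    (hj : ∀ s : L, twistedTransport ⟨fun z ↦ g⁻¹ • z, continuous_const_smul _⟩ δ
      (inv_smul_smul g e) (j (ofAdd s)) = j (ofAdd (T s))) :
    ∃ (ι : Multiplicative L →* FundamentalGroup X (q e)) (γ₀ : FundamentalGroup X (q e)),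
      Function.Injective ι ∧ ι.range.Normal ∧ ι.range.index = p ∧
        ∀ s : L, γ₀ * ι (ofAdd s) * γ₀⁻¹ = ι (ofAdd (T s)) := by
  set f : C(E, X) := ⟨q, hq.isCoveringMap.continuous⟩ with hf
  set ι₁ : FundamentalGroup E e →* FundamentalGroup X (q e) := FundamentalGroup.map f e with hι₁
  have hιeq : FundamentalGroup.mapOfEq f (⟨e, rfl⟩ : q ⁻¹' {q e}).2 = ι₁ :=
    MonoidHom.ext (mapOfEq_rfl_apply f e)
  have hinj : Function.Injective ι₁ :=
    hιeq ▸ mapOfEq_injective_of_isCoveringMap hq.isCoveringMap ⟨e, rfl⟩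
  have hnorm : ι₁.range.Normal := hιeq ▸ QuotientCovering.normal_range_mapOfEq hq ⟨e, rfl⟩
  have hidx : ι₁.range.index = p := by
    rw [← hιeq, QuotientCovering.index_range_mapOfEq hq ⟨e, rfl⟩, hG]
  set ιN : Multiplicative L →* FundamentalGroup X (q e) := ι₁.comp j.toMonoidHom with hιN
  have hrange : ιN.range = ι₁.range := by
    rw [hιN, MonoidHom.range_comp, MonoidHom.range_eq_top.2 j.surjective, ← MonoidHom.range_eq_map]
  have hinjN : Function.Injective ιN := hinj.comp j.injective
  have hnormN : ιN.range.Normal := hrange ▸ hnorm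
  have hidxN : ιN.range.index = p := by rw [hrange, hidx]
  have hT : ∀ z, f ((⟨fun z ↦ g⁻¹ • z, continuous_const_smul _⟩ : C(E, E)) z) = f z :=
    fun z ↦ (hq.apply_eq_iff_mem_orbit).2 (MulAction.mem_orbit _ _)
  set γ := baseLoop f δ (by rw [← hT (g • e)]; simp) with hγ
  refine ⟨ιN, γ, hinjN, hnormN, hidxN, fun s ↦ ?_⟩
  have := map_twistedTransport_eq_conj f ⟨fun z ↦ g⁻¹ • z, continuous_const_smul _⟩ hT δ
    (inv_smul_smul g e) (j (ofAdd s))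
  rw [hj] at this
  exact this.symm

/-- **The datum descends from `A` to `Y × A` for `Y` simply connected** (one side of
`isEmpty_homeomorph_of_quotientCovering_prod`): for `G` acting on `Y` and on `A` with
`g • a = a`, `π₁(A, a)` abelian and `j : L ≅ π₁(A, a)` carrying `T` to `(g⁻¹)_*`, there are a path
`δ : (y, a) ⟶ g • (y, a)` and `J : L ≅ π₁(Y × A, (y, a))` carrying `T` to the twisted transport
of `g⁻¹` along `δ` (the projection `π₁(Y × A) → π₁(A)` is an isomorphism, Hatcher 1.12, and
twisted transport is natural in it). [cite: HatcherAT2002, Prop. 1.12 (p. 34)] -/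
theorem exists_prodModel_of_fixedPoint {L : Type*} [AddGroup L] (T : L → L)
    {Y A G : Type*} [TopologicalSpace Y] [TopologicalSpace A] [SimplyConnectedSpace Y]
    [PathConnectedSpace A] [Group G] [MulAction G Y] [MulAction G A] [ContinuousConstSMul G Y]
    [ContinuousConstSMul G A] (y : Y) (a : A) (g : G) (hg : g • a = a)
    (hcomm : ∀ u v : FundamentalGroup A a, u * v = v * u)
    (j : Multiplicative L ≃* FundamentalGroup A a)
    (hj : ∀ s : L, FundamentalGroup.mapOfEq (⟨fun a ↦ g⁻¹ • a, continuous_const_smul _⟩ :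
      C(A, A)) (inv_smul_eq_iff.2 hg.symm) (j (ofAdd s)) = j (ofAdd (T s))) :
    ∃ (δ : Path (y, a) (g • (y, a))) (J : Multiplicative L ≃* FundamentalGroup (Y × A) (y, a)),
      ∀ s : L, twistedTransport ⟨fun z ↦ g⁻¹ • z, continuous_const_smul _⟩ δ
        (inv_smul_smul g (y, a)) (J (ofAdd s)) = J (ofAdd (T s)) := by
  let snd₁ : C(Y × A, A) := ⟨Prod.snd, continuous_snd⟩
  let σ₁ : FundamentalGroup (Y × A) (y, a) ≃* FundamentalGroup A a :=
    MulEquiv.ofBijective (FundamentalGroup.map snd₁ (y, a))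
      (bijective_map_snd_of_simplyConnectedSpace y a)
  let J₁ : Multiplicative L ≃* FundamentalGroup (Y × A) (y, a) := j.trans σ₁.symm
  let δ₁ : Path (y, a) (g • (y, a)) :=
    (PathConnectedSpace.somePath y (g • y)).prod ((Path.refl a).cast rfl hg)
  refine ⟨δ₁, J₁, fun s ↦ ?_⟩
  apply (bijective_map_snd_of_simplyConnectedSpace (Y := Y) y a).1
  have hnat := map_twistedTransport_of_semiconj snd₁
    (⟨fun z ↦ g⁻¹ • z, continuous_const_smul _⟩ : C(Y × A, Y × A))
    (⟨fun a ↦ g⁻¹ • a, continuous_const_smul _⟩ : C(A, A)) (fun _ ↦ rfl) δ₁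
    (inv_smul_smul g (y, a)) (J₁ (ofAdd s))
  rw [hnat]
  have hσJ : ∀ x, FundamentalGroup.map snd₁ (y, a) (J₁ x) = j x := fun x ↦
    σ₁.apply_symm_apply (j x)
  rw [hσJ, hσJ, twistedTransport_eq_mapOfEq_of_comm' _ _ hg _ (inv_smul_eq_iff.2 hg.symm)
    hcomm, hj]

/-- **The datum for a torus model, one side** (one side of `isEmpty_homeomorph_of_torusModels`):
for a torus `V/Λ` (`V` simply connected commutative topological group, `Λ` discrete), an additive
continuous `M : V → V` preserving `Λ`, `ε : L ≅ Λ` carrying `T` to `M`, and `g` acting on `V/Λ`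
as the torus map of `M`, the point `0` is fixed by `g`, `π₁(V/Λ, 0)` is abelian and some
`j : L ≅ π₁(V/Λ, 0)` carries `T` to `(g⁻¹)_*` (Hatcher, Example 1.13; the tree's
`exists_mulEquiv_fundamentalGroup_torus`). [cite: HatcherAT2002, Example 1.13 and Prop. 1.39] -/
theorem exists_torusModel_datum {L : Type*} [AddCommGroup L] (T : L → L)
    {V G : Type*} [AddCommGroup V] [TopologicalSpace V] [IsTopologicalAddGroup V]
    [SimplyConnectedSpace V] (Λ : AddSubgroup V) (hΛ : IsDiscrete (Λ : Set V))
    (M : V →+ V) (hMc : Continuous M) (hM : ∀ v ∈ Λ, M v ∈ Λ)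
    (ε : L ≃+ Λ) (hε : ∀ s : L, ((ε (T s) : Λ) : V) = M (ε s))
    [Group G] [MulAction G (V ⧸ Λ)] [ContinuousConstSMul G (V ⧸ Λ)] (g : G)
    (hg : ∀ a : V ⧸ Λ, g⁻¹ • a = torusMap Λ M hMc hM a) :
    ∃ (hfix : g • ((0 : V) : V ⧸ Λ) = ((0 : V) : V ⧸ Λ))
      (j : Multiplicative L ≃* FundamentalGroup (V ⧸ Λ) ((0 : V) : V ⧸ Λ)),
      (∀ u v : FundamentalGroup (V ⧸ Λ) ((0 : V) : V ⧸ Λ), u * v = v * u) ∧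
      ∀ s : L, FundamentalGroup.mapOfEq (⟨fun a ↦ g⁻¹ • a, continuous_const_smul _⟩ :
        C(V ⧸ Λ, V ⧸ Λ)) (inv_smul_eq_iff.2 hfix.symm) (j (ofAdd s)) = j (ofAdd (T s)) := by
  obtain ⟨j, hj, hcomm⟩ := exists_mulEquiv_fundamentalGroup_torus Λ hΛ M hMc hM T ε hε
  have hfix : g • ((0 : V) : V ⧸ Λ) = ((0 : V) : V ⧸ Λ) := by
    have h := hg ((0 : V) : V ⧸ Λ)
    rw [torusMap_mk, map_zero] at h
    conv_lhs => rw [← h]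
    exact smul_inv_smul g _
  have hmap : (⟨fun a ↦ g⁻¹ • a, continuous_const_smul _⟩ : C(V ⧸ Λ, V ⧸ Λ)) =
      torusMap Λ M hMc hM := ContinuousMap.ext hg
  refine ⟨hfix, j, hcomm, fun s ↦ ?_⟩
  rw [mapOfEq_congr_map hmap _ (by rw [torusMap_mk, map_zero]) (j (ofAdd s)), hj]

end OneSided

/-! ### Serre's topological half for `p = 23`, unconditionally -/

section TwentyThree

variable {K : Type*} [Field K] [NumberField K] [IsCyclotomicExtension {23} ℚ K] {ζ : K}

/-- **Serre 1964, Théorème, for topological models, `p = 23`, no class-number hypothesis.** As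
`isEmpty_mulEquiv_fundamentalGroup_of_quotientCovering`, with `K₀ = K ⊇ ℚ(ζ₂₃)`, the lattice of
the second model `𝔭·𝓞 K` for `𝔭 = (2, ω) ⊂ 𝓞 ℚ(ω)`, `ω² = ω - 6` (`exists_models_data`), and the
algebraic input `isEmpty_mulEquiv_twentyThree` instead of `isEmpty_mulEquiv_numberField`.
[cite: Serre1964Conjugate, no. 2 and Théorème p. 4196] -/
theorem isEmpty_mulEquiv_fundamentalGroup_of_quotientCovering_twentyThree
    (hζ : IsPrimitiveRoot ζ 23) {ω : K} (hω : ω ^ 2 = ω - 6) (w : 𝓞 ℚ⟮ω⟯)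
    (hw : (w : ℚ⟮ω⟯) = AdjoinSimple.gen ℚ ω)
    {E₁ X₁ G₁ : Type*} [TopologicalSpace E₁] [TopologicalSpace X₁] [Group G₁] [MulAction G₁ E₁]
    [ContinuousConstSMul G₁ E₁] [PathConnectedSpace E₁] {q₁ : E₁ → X₁}
    (hq₁ : IsQuotientCoveringMap q₁ G₁)
    (hG₁ : Nat.card G₁ = 23) (e₁ : E₁) (g₁ : G₁) (δ₁ : Path e₁ (g₁ • e₁))
    (j₁ : Multiplicative (𝓞 K) ≃* FundamentalGroup E₁ e₁)
    (hj₁ : ∀ s : 𝓞 K, twistedTransport ⟨fun z ↦ g₁⁻¹ • z, continuous_const_smul _⟩ δ₁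
      (inv_smul_smul g₁ e₁) (j₁ (ofAdd s)) = j₁ (ofAdd (hζ.toInteger * s)))
    {E₂ X₂ G₂ : Type*} [TopologicalSpace E₂] [TopologicalSpace X₂] [Group G₂] [MulAction G₂ E₂]
    [ContinuousConstSMul G₂ E₂] [PathConnectedSpace E₂] {q₂ : E₂ → X₂}
    (hq₂ : IsQuotientCoveringMap q₂ G₂)
    (hG₂ : Nat.card G₂ = 23) (e₂ : E₂) (g₂ : G₂) (δ₂ : Path e₂ (g₂ • e₂))
    (j₂ : Multiplicative ↥((Ideal.span {(2 : 𝓞 ℚ⟮ω⟯), w}).map (algebraMap (𝓞 ℚ⟮ω⟯) (𝓞 K))) ≃*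
      FundamentalGroup E₂ e₂)
    (hj₂ : ∀ b : ↥((Ideal.span {(2 : 𝓞 ℚ⟮ω⟯), w}).map (algebraMap (𝓞 ℚ⟮ω⟯) (𝓞 K))),
      twistedTransport ⟨fun z ↦ g₂⁻¹ • z, continuous_const_smul _⟩ δ₂
        (inv_smul_smul g₂ e₂) (j₂ (ofAdd b)) = j₂ (ofAdd (hζ.toInteger • b))) :
    IsEmpty (FundamentalGroup X₁ (q₁ e₁) ≃* FundamentalGroup X₂ (q₂ e₂)) := by
  obtain ⟨ι, γ₀, hι, hN, hιi, hγ₀⟩ :=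
    exists_model_of_quotientCovering (fun s ↦ hζ.toInteger * s) hq₁ hG₁ e₁ g₁ δ₁ j₁ hj₁
  obtain ⟨ι', γ₀', hι', hN', hι'i, hγ₀'⟩ :=
    exists_model_of_quotientCovering (fun b ↦ hζ.toInteger • b) hq₂ hG₂ e₂ g₂ δ₂ j₂ hj₂
  exact isEmpty_mulEquiv_twentyThree hζ hω w hw ι hι hιi γ₀ hγ₀ ι' hι' hι'i γ₀' hγ₀'

/-- **Serre 1964 for torus models, `p = 23`, no class-number hypothesis.** As
`isEmpty_homeomorph_of_torusModels`: tori `Vᵢ/Λᵢ` with `Λ₁ ≅ 𝓞 K`, `Λ₂ ≅ 𝔭·𝓞 K` (`K ⊇ ℚ(ζ₂₃)`,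
`𝔭 = (2, ω)`), multiplication by `ζ₂₃` being the restriction of additive continuous `Mᵢ`, groups
of order `23` acting on simply connected `Yᵢ` and on the tori (a generator through `Mᵢ`) with
quotient covering maps `qᵢ : Yᵢ × Vᵢ/Λᵢ → Xᵢ`: then `X₁ ≄ₜ X₂`.
[cite: Serre1964Conjugate, nos. 1–2 and Théorème p. 4196] -/
theorem isEmpty_homeomorph_of_torusModels_twentyThree
    (hζ : IsPrimitiveRoot ζ 23) {ω : K} (hω : ω ^ 2 = ω - 6) (w : 𝓞 ℚ⟮ω⟯)
    (hw : (w : ℚ⟮ω⟯) = AdjoinSimple.gen ℚ ω)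
    -- model 1
    {Y₁ V₁ X₁ G₁ : Type*} [TopologicalSpace Y₁] [SimplyConnectedSpace Y₁] [AddCommGroup V₁]
    [TopologicalSpace V₁] [IsTopologicalAddGroup V₁] [SimplyConnectedSpace V₁]
    [TopologicalSpace X₁] (Λ₁ : AddSubgroup V₁) (hΛ₁ : IsDiscrete (Λ₁ : Set V₁))
    (M₁ : V₁ →+ V₁) (hM₁c : Continuous M₁) (hM₁ : ∀ v ∈ Λ₁, M₁ v ∈ Λ₁)
    (ε₁ : 𝓞 K ≃+ Λ₁) (hε₁ : ∀ s : 𝓞 K, ((ε₁ (hζ.toInteger * s) : Λ₁) : V₁) = M₁ (ε₁ s))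
    [Group G₁] [MulAction G₁ Y₁] [MulAction G₁ (V₁ ⧸ Λ₁)] [ContinuousConstSMul G₁ Y₁]
    [ContinuousConstSMul G₁ (V₁ ⧸ Λ₁)] {q₁ : Y₁ × (V₁ ⧸ Λ₁) → X₁}
    (hq₁ : IsQuotientCoveringMap q₁ G₁) (hG₁ : Nat.card G₁ = 23) (g₁ : G₁)
    (hg₁ : ∀ a : V₁ ⧸ Λ₁, g₁⁻¹ • a = torusMap Λ₁ M₁ hM₁c hM₁ a)
    -- model 2
    {Y₂ V₂ X₂ G₂ : Type*} [TopologicalSpace Y₂] [SimplyConnectedSpace Y₂] [AddCommGroup V₂]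
    [TopologicalSpace V₂] [IsTopologicalAddGroup V₂] [SimplyConnectedSpace V₂]
    [TopologicalSpace X₂] (Λ₂ : AddSubgroup V₂) (hΛ₂ : IsDiscrete (Λ₂ : Set V₂))
    (M₂ : V₂ →+ V₂) (hM₂c : Continuous M₂) (hM₂ : ∀ v ∈ Λ₂, M₂ v ∈ Λ₂)
    (ε₂ : ↥((Ideal.span {(2 : 𝓞 ℚ⟮ω⟯), w}).map (algebraMap (𝓞 ℚ⟮ω⟯) (𝓞 K))) ≃+ Λ₂)
    (hε₂ : ∀ b : ↥((Ideal.span {(2 : 𝓞 ℚ⟮ω⟯), w}).map (algebraMap (𝓞 ℚ⟮ω⟯) (𝓞 K))),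
      ((ε₂ (hζ.toInteger • b) : Λ₂) : V₂) = M₂ (ε₂ b))
    [Group G₂] [MulAction G₂ Y₂] [MulAction G₂ (V₂ ⧸ Λ₂)] [ContinuousConstSMul G₂ Y₂]
    [ContinuousConstSMul G₂ (V₂ ⧸ Λ₂)] {q₂ : Y₂ × (V₂ ⧸ Λ₂) → X₂}
    (hq₂ : IsQuotientCoveringMap q₂ G₂) (hG₂ : Nat.card G₂ = 23) (g₂ : G₂)
    (hg₂ : ∀ a : V₂ ⧸ Λ₂, g₂⁻¹ • a = torusMap Λ₂ M₂ hM₂c hM₂ a) :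
    IsEmpty (X₁ ≃ₜ X₂) := by
  haveI : PathConnectedSpace (V₁ ⧸ Λ₁) :=
    (QuotientAddGroup.mk_surjective (s := Λ₁)).pathConnectedSpace QuotientAddGroup.continuous_mk
  haveI : PathConnectedSpace (V₂ ⧸ Λ₂) :=
    (QuotientAddGroup.mk_surjective (s := Λ₂)).pathConnectedSpace QuotientAddGroup.continuous_mk
  obtain ⟨hfix₁, j₁, hcomm₁, hj₁⟩ :=
    exists_torusModel_datum (fun s ↦ hζ.toInteger * s) Λ₁ hΛ₁ M₁ hM₁c hM₁ ε₁ hε₁ g₁ hg₁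
  obtain ⟨hfix₂, j₂, hcomm₂, hj₂⟩ :=
    exists_torusModel_datum (fun b ↦ hζ.toInteger • b) Λ₂ hΛ₂ M₂ hM₂c hM₂ ε₂ hε₂ g₂ hg₂
  obtain ⟨δ₁, J₁, hJ₁⟩ := exists_prodModel_of_fixedPoint (fun s ↦ hζ.toInteger * s)
    (Classical.arbitrary Y₁) ((0 : V₁) : V₁ ⧸ Λ₁) g₁ hfix₁ hcomm₁ j₁ hj₁
  obtain ⟨δ₂, J₂, hJ₂⟩ := exists_prodModel_of_fixedPoint (fun b ↦ hζ.toInteger • b)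
    (Classical.arbitrary Y₂) ((0 : V₂) : V₂ ⧸ Λ₂) g₂ hfix₂ hcomm₂ j₂ hj₂
  haveI : PathConnectedSpace X₂ := hq₂.surjective.pathConnectedSpace hq₂.isCoveringMap.continuous
  refine ⟨fun f ↦ (isEmpty_mulEquiv_fundamentalGroup_of_quotientCovering_twentyThree hζ hω w hw
    hq₁ hG₁ _ g₁ δ₁ J₁ hJ₁ hq₂ hG₂ _ g₂ δ₂ J₂ hJ₂).false ?_⟩
  exact (fundamentalGroupEquivOfHomeomorph f rfl).trans
    (FundamentalGroup.fundamentalGroupMulEquivOfPathConnected (f (q₁ _)) (q₂ _))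

/-- **Serre 1964 for lattice models, orbit-space form, `p = 23`, no class-number hypothesis.** As
`isEmpty_homeomorph_orbitSpace_of_latticeModels`: `Vᵢ` finite-dimensional real normed spaces,
`Lᵢ ⊂ Vᵢ` discrete additive subgroups with `L₁ ≅ 𝓞 K`, `L₂ ≅ 𝔭·𝓞 K` (`K ⊇ ℚ(ζ₂₃)`,
`𝔭 = (2, ω) ⊂ 𝓞 ℚ(ω)`, `ω² = ω - 6`), `Mᵢ` real-linear preserving `Lᵢ` and restricting there to
multiplication by `ζ₂₃`, finite groups of order `23` acting freely and continuously on
`Yᵢ × Vᵢ/Lᵢ` (`Yᵢ` simply connected, locally compact, Hausdorff), a generator acting on the torus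
through `Mᵢ` ("`V` le quotient de `Y × A` par `G`", `A_φ(ℂ) = ℂ¹¹/Λ_φ`, `Λ_φ ≅ S`,
`Λ_ψ ≅ 𝔭S`): the orbit spaces `(Y₁ × V₁/L₁)/G₁`, `(Y₂ × V₂/L₂)/G₂` are not homeomorphic.
[cite: Serre1964Conjugate, nos. 1–2 and Théorème p. 4196] [cite: HatcherAT2002, Prop. 1.40] -/
theorem isEmpty_homeomorph_orbitSpace_of_latticeModels_twentyThree
    (hζ : IsPrimitiveRoot ζ 23) {ω : K} (hω : ω ^ 2 = ω - 6) (w : 𝓞 ℚ⟮ω⟯)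
    (hw : (w : ℚ⟮ω⟯) = AdjoinSimple.gen ℚ ω)
    -- model 1
    {Y₁ V₁ G₁ : Type*} [TopologicalSpace Y₁] [SimplyConnectedSpace Y₁] [LocallyCompactSpace Y₁]
    [T2Space Y₁] [NormedAddCommGroup V₁] [NormedSpace ℝ V₁] [FiniteDimensional ℝ V₁]
    (L₁ : Submodule ℤ V₁) [DiscreteTopology L₁] (M₁ : V₁ →ₗ[ℝ] V₁) (hM₁ : ∀ v ∈ L₁, M₁ v ∈ L₁)
    (ε₁ : 𝓞 K ≃+ L₁.toAddSubgroup)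
    (hε₁ : ∀ s : 𝓞 K, ((ε₁ (hζ.toInteger * s) : L₁.toAddSubgroup) : V₁) = M₁ (ε₁ s))
    [Group G₁] [Finite G₁] [MulAction G₁ Y₁] [MulAction G₁ (V₁ ⧸ L₁.toAddSubgroup)]
    [ContinuousConstSMul G₁ Y₁] [ContinuousConstSMul G₁ (V₁ ⧸ L₁.toAddSubgroup)]
    (hG₁ : Nat.card G₁ = 23)
    (hfree₁ : ∀ (g : G₁) (z : Y₁ × (V₁ ⧸ L₁.toAddSubgroup)), g • z = z → g = 1) (g₁ : G₁)
    (hg₁ : ∀ a : V₁ ⧸ L₁.toAddSubgroup, g₁⁻¹ • a = torusMap L₁.toAddSubgroup M₁.toAddMonoidHom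
      M₁.continuous_of_finiteDimensional hM₁ a)
    -- model 2
    {Y₂ V₂ G₂ : Type*} [TopologicalSpace Y₂] [SimplyConnectedSpace Y₂] [LocallyCompactSpace Y₂]
    [T2Space Y₂] [NormedAddCommGroup V₂] [NormedSpace ℝ V₂] [FiniteDimensional ℝ V₂]
    (L₂ : Submodule ℤ V₂) [DiscreteTopology L₂] (M₂ : V₂ →ₗ[ℝ] V₂) (hM₂ : ∀ v ∈ L₂, M₂ v ∈ L₂)
    (ε₂ : ↥((Ideal.span {(2 : 𝓞 ℚ⟮ω⟯), w}).map (algebraMap (𝓞 ℚ⟮ω⟯) (𝓞 K))) ≃+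
      L₂.toAddSubgroup)
    (hε₂ : ∀ b : ↥((Ideal.span {(2 : 𝓞 ℚ⟮ω⟯), w}).map (algebraMap (𝓞 ℚ⟮ω⟯) (𝓞 K))),
      ((ε₂ (hζ.toInteger • b) : L₂.toAddSubgroup) : V₂) = M₂ (ε₂ b))
    [Group G₂] [Finite G₂] [MulAction G₂ Y₂] [MulAction G₂ (V₂ ⧸ L₂.toAddSubgroup)]
    [ContinuousConstSMul G₂ Y₂] [ContinuousConstSMul G₂ (V₂ ⧸ L₂.toAddSubgroup)]
    (hG₂ : Nat.card G₂ = 23)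
    (hfree₂ : ∀ (g : G₂) (z : Y₂ × (V₂ ⧸ L₂.toAddSubgroup)), g • z = z → g = 1) (g₂ : G₂)
    (hg₂ : ∀ a : V₂ ⧸ L₂.toAddSubgroup, g₂⁻¹ • a = torusMap L₂.toAddSubgroup M₂.toAddMonoidHom
      M₂.continuous_of_finiteDimensional hM₂ a) :
    IsEmpty (MulAction.orbitRel.Quotient G₁ (Y₁ × (V₁ ⧸ L₁.toAddSubgroup)) ≃ₜ
      MulAction.orbitRel.Quotient G₂ (Y₂ × (V₂ ⧸ L₂.toAddSubgroup))) := by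
  haveI : IsCancelSMul G₁ (Y₁ × (V₁ ⧸ L₁.toAddSubgroup)) :=
    isCancelSMul_iff_eq_one_of_smul_eq.2 hfree₁
  haveI : IsCancelSMul G₂ (Y₂ × (V₂ ⧸ L₂.toAddSubgroup)) :=
    isCancelSMul_iff_eq_one_of_smul_eq.2 hfree₂
  exact isEmpty_homeomorph_of_torusModels_twentyThree hζ hω w hw L₁.toAddSubgroup
    DiscreteTopology.isDiscrete M₁.toAddMonoidHom M₁.continuous_of_finiteDimensional hM₁ ε₁ hε₁
    (isQuotientCoveringMap_quotientMk_of_properlyDiscontinuousSMul (G := G₁)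
      (E := Y₁ × (V₁ ⧸ L₁.toAddSubgroup))) hG₁ g₁ hg₁
    L₂.toAddSubgroup DiscreteTopology.isDiscrete M₂.toAddMonoidHom
    M₂.continuous_of_finiteDimensional hM₂ ε₂ hε₂
    (isQuotientCoveringMap_quotientMk_of_properlyDiscontinuousSMul (G := G₂)
      (E := Y₂ × (V₂ ⧸ L₂.toAddSubgroup))) hG₂ g₂ hg₂

end TwentyThree

/-! ### Back to the barrier fact -/

section Fact

open Literature.AlgebraicGeometry.Motives

/-- **Serre 1964 for `p = 23`: the fact from lattice models of the complex points, with no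
class-number hypothesis.** Let `V` be smooth projective over a number field `H` with embeddings
`φ, ψ : H →+* ℂ`, and suppose `V_φ(ℂ) ≃ₜ (Y₁ × V₁/L₁)/G₁`, `V_ψ(ℂ) ≃ₜ (Y₂ × V₂/L₂)/G₂` for lattice
models as in `isEmpty_homeomorph_orbitSpace_of_latticeModels_twentyThree` — `Yᵢ` simply connected
locally compact Hausdorff ("`Y` … simplement connexe", Lefschetz), `Lᵢ` discrete subgroups of
finite-dimensional real vector spaces with `L₁ ≅ 𝓞 K`, `L₂ ≅ 𝔭·𝓞 K` (`K ⊇ ℚ(ζ₂₃)`,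
`𝔭 = (2, ω) ⊂ 𝓞 ℚ(ω)`, `ω² = ω - 6`; "`π₁(A_φ)` … libre", "`π₁(A_ψ)` … ne l'est pas", `p = 23`,
`h = 3`), free actions of groups of order `23`, a generator acting on the torus through a linear
`Mᵢ` which is multiplication by `ζ₂₃` on `Lᵢ` ("`S` opère sur `A`").  Then
`Serre1964_conjugateVarieties_notHomeomorphic` holds (`serre1964_of_numberField_form`).  For Serre's
`V = (Y × E¹¹)/(ℤ/23)` over the Hilbert class field of `ℚ(√-23)` these homeomorphisms are the
uniformisation `A_φ(ℂ) = ℂ¹¹/π₁(A_φ)`, `π₁(A_φ) = π₁(E_φ)¹¹ ≅ S`, `π₁(A_ψ) ≅ 𝔭S` (CM theory) and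
`V_φ(ℂ) = (Y(ℂ) × A_φ(ℂ))/G` — the algebro-geometric remainder of the proof.
[cite: Serre1964Conjugate, nos. 1–2 and Théorème p. 4196] -/
theorem serre1964_twentyThree_of_latticeModels
    {K : Type*} [Field K] [NumberField K] [IsCyclotomicExtension {23} ℚ K] {ζ : K}
    (hζ : IsPrimitiveRoot ζ 23) {ω : K} (hω : ω ^ 2 = ω - 6) (w : 𝓞 ℚ⟮ω⟯)
    (hw : (w : ℚ⟮ω⟯) = AdjoinSimple.gen ℚ ω)
    -- model 1
    {Y₁ V₁ G₁ : Type*} [TopologicalSpace Y₁] [SimplyConnectedSpace Y₁] [LocallyCompactSpace Y₁]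
    [T2Space Y₁] [NormedAddCommGroup V₁] [NormedSpace ℝ V₁] [FiniteDimensional ℝ V₁]
    (L₁ : Submodule ℤ V₁) [DiscreteTopology L₁] (M₁ : V₁ →ₗ[ℝ] V₁) (hM₁ : ∀ v ∈ L₁, M₁ v ∈ L₁)
    (ε₁ : 𝓞 K ≃+ L₁.toAddSubgroup)
    (hε₁ : ∀ s : 𝓞 K, ((ε₁ (hζ.toInteger * s) : L₁.toAddSubgroup) : V₁) = M₁ (ε₁ s))
    [Group G₁] [Finite G₁] [MulAction G₁ Y₁] [MulAction G₁ (V₁ ⧸ L₁.toAddSubgroup)]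
    [ContinuousConstSMul G₁ Y₁] [ContinuousConstSMul G₁ (V₁ ⧸ L₁.toAddSubgroup)]
    (hG₁ : Nat.card G₁ = 23)
    (hfree₁ : ∀ (g : G₁) (z : Y₁ × (V₁ ⧸ L₁.toAddSubgroup)), g • z = z → g = 1) (g₁ : G₁)
    (hg₁ : ∀ a : V₁ ⧸ L₁.toAddSubgroup, g₁⁻¹ • a = torusMap L₁.toAddSubgroup M₁.toAddMonoidHom
      M₁.continuous_of_finiteDimensional hM₁ a)
    -- model 2
    {Y₂ V₂ G₂ : Type*} [TopologicalSpace Y₂] [SimplyConnectedSpace Y₂] [LocallyCompactSpace Y₂]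
    [T2Space Y₂] [NormedAddCommGroup V₂] [NormedSpace ℝ V₂] [FiniteDimensional ℝ V₂]
    (L₂ : Submodule ℤ V₂) [DiscreteTopology L₂] (M₂ : V₂ →ₗ[ℝ] V₂) (hM₂ : ∀ v ∈ L₂, M₂ v ∈ L₂)
    (ε₂ : ↥((Ideal.span {(2 : 𝓞 ℚ⟮ω⟯), w}).map (algebraMap (𝓞 ℚ⟮ω⟯) (𝓞 K))) ≃+
      L₂.toAddSubgroup)
    (hε₂ : ∀ b : ↥((Ideal.span {(2 : 𝓞 ℚ⟮ω⟯), w}).map (algebraMap (𝓞 ℚ⟮ω⟯) (𝓞 K))),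
      ((ε₂ (hζ.toInteger • b) : L₂.toAddSubgroup) : V₂) = M₂ (ε₂ b))
    [Group G₂] [Finite G₂] [MulAction G₂ Y₂] [MulAction G₂ (V₂ ⧸ L₂.toAddSubgroup)]
    [ContinuousConstSMul G₂ Y₂] [ContinuousConstSMul G₂ (V₂ ⧸ L₂.toAddSubgroup)]
    (hG₂ : Nat.card G₂ = 23)
    (hfree₂ : ∀ (g : G₂) (z : Y₂ × (V₂ ⧸ L₂.toAddSubgroup)), g • z = z → g = 1) (g₂ : G₂)
    (hg₂ : ∀ a : V₂ ⧸ L₂.toAddSubgroup, g₂⁻¹ • a = torusMap L₂.toAddSubgroup M₂.toAddMonoidHom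
      M₂.continuous_of_finiteDimensional hM₂ a)
    -- the variety and the two homeomorphisms with the models
    {H : Type} [Field H] [NumberField H] {n : ℕ} {V : SchemeOver H} (hV : IsSmoothProjective n V)
    (φ ψ : H →+* ℂ)
    (eφ : ComplexPoints ((baseChangeHom φ).obj V) ≃ₜ
      MulAction.orbitRel.Quotient G₁ (Y₁ × (V₁ ⧸ L₁.toAddSubgroup)))
    (eψ : ComplexPoints ((baseChangeHom ψ).obj V) ≃ₜ
      MulAction.orbitRel.Quotient G₂ (Y₂ × (V₂ ⧸ L₂.toAddSubgroup))) :
    Serre1964_conjugateVarieties_notHomeomorphic := by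
  refine serre1964_of_numberField_form hV φ ψ ⟨fun f ↦ ?_⟩
  exact (isEmpty_homeomorph_orbitSpace_of_latticeModels_twentyThree hζ hω w hw L₁ M₁ hM₁ ε₁ hε₁
    hG₁ hfree₁ g₁ hg₁ L₂ M₂ hM₂ ε₂ hε₂ hG₂ hfree₂ g₂ hg₂).false (eφ.symm.trans (f.trans eψ))

end Fact

end Literature.Barriers.HodgeConjecture.Serre1964

end
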